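import Summits.CriticalPhenomena.PercolationContinuityZ3.Theorems.PercNearOneGluingNoHeavyConstsMDLXJointXEdgeInduction
import HarnessLib

/-!
# CROSS members: layer cake — from 0/1-valued monotone functionals (edge up-sets) to all monotone functionals of a marker class

builds on p205010 (kernel theorem, internal audit signed; external expert review pending).  Support file (`--supports
stmt-CriticalPhenomena-4575`); theorems only, no sorries, standard axioms.  Memo `run/shared/lean/prim/consts/FROM-prim-consts-2-g21-GIBBS-ORBIT.md` §5(v).

`Consts.CrossRel` asks for the two CROSS members (`Consts.polMargin` sums, `X' = X ∪ {u}`) to be `≥ 0` for EVERY monotone functional `F` of the open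
edge cluster; the exchange calculus proves them for INDICATORS of up-sets.  The members are linear in `F` and vanish on constants
(`Consts.polMargin_add_mul`, `Consts.polMargin_const'`), so a finite layer-cake induction on the number of values of `F` transfers positivity from the
indicators of the level sets `{F ≥ t}` to `F`, inside any class of functionals closed under taking level sets:
* `Consts.crossMembers_nonneg_of_levelSets_pinned` — if both members are `≥ 0` for every monotone 0/1-valued `G` with `G(C_s) = 1 ⟹ s↔y`, then
  they are `≥ 0` for every monotone `F` with `F(C_s) ≠ F(∅) ⟹ s↔y` (the marker-PINNED functionals: `F − F(∅)` supported on `{s↔y}`);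
* `Consts.crossMembers_nonneg_of_levelSets_saturated` — if both members are `≥ 0` for every monotone 0/1-valued `G` with `s↔y ⟹ G(C_s) = 1`,
  then they are `≥ 0` for every monotone `F` with `s↔y ⟹ F(C_s) = F(univ)` (the marker-SATURATED functionals).
The hypotheses are exactly the conclusions of `Consts.crossRel_edge_M1/M2_of_markerPinned` and `Consts.crossRel_edge_of_markerSaturated` (gen 21,
edge-cluster exchanges), for any added vertex `u` (stated for general `u`; used at `u = z`).
-/

noncomputable section

namespace Summit.CriticalPhenomena.PercolationContinuityZ3.Theorems

open MeasureTheory Set Literature.Probability.LatticeModels Literature.Probability.Percolation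
open scoped Classical

namespace Consts

variable {V : Type*} [Fintype V]

/-- The polarised margin is linear in the functional. [folklore] -/
theorem polMargin_add_mul (w : Sym2 V → unitInterval) (s y z : V) (F G : Set (Sym2 V) → ℝ) (c : ℝ) (X₀ X₁ X₂ : Set V) :
    polMargin (prodBernoulli w) s y z (fun C => F C + c * G C) X₀ X₁ X₂ =
      polMargin (prodBernoulli w) s y z F X₀ X₁ X₂ + c * polMargin (prodBernoulli w) s y z G X₀ X₁ X₂ := by
  unfold polMargin
  have h : ∀ S : Set (BondConfig V), ∫ ω in S, (F (openEdgeCluster ω s) + c * G (openEdgeCluster ω s)) ∂(prodBernoulli w) =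
      (∫ ω in S, F (openEdgeCluster ω s) ∂(prodBernoulli w)) + c * ∫ ω in S, G (openEdgeCluster ω s) ∂(prodBernoulli w) := by
    intro S
    rw [integral_add Integrable.of_finite Integrable.of_finite, integral_const_mul]
  simp only [h]
  ring

omit [Fintype V] in
/-- The polarised margin vanishes on constant functionals. [folklore] -/
theorem polMargin_const' (w : Sym2 V → unitInterval) (s y z : V) (c : ℝ) (X₀ X₁ X₂ : Set V) :
    polMargin (prodBernoulli w) s y z (fun _ => c) X₀ X₁ X₂ = 0 := by
  unfold polMargin
  simp only [setIntegral_const, smul_eq_mul]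
  ring

/-- **Layer cake, pinned class.**  See the module docstring. [folklore; cite: VandenbergHaggstromKahn2005, §2.1 (pp. 9–13) for the members] -/
theorem crossMembers_nonneg_of_levelSets_pinned (w : Sym2 V → unitInterval) (s y z u : V) (X : Set V)
    (h01 : ∀ G : Set (Sym2 V) → ℝ, Monotone G → (∀ C, G C = 0 ∨ G C = 1) →
      (∀ ω : BondConfig V, G (openEdgeCluster ω s) = 1 → (openGraph ω).Reachable s y) →
      (0 ≤ polMargin (prodBernoulli w) s y z G (insert u X) X X + polMargin (prodBernoulli w) s y z G X (insert u X) X +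
          polMargin (prodBernoulli w) s y z G X X (insert u X)) ∧
        0 ≤ polMargin (prodBernoulli w) s y z G (insert u X) (insert u X) X + polMargin (prodBernoulli w) s y z G (insert u X) X (insert u X) +
          polMargin (prodBernoulli w) s y z G X (insert u X) (insert u X))
    (F : Set (Sym2 V) → ℝ) (hF : Monotone F)
    (hFy : ∀ ω : BondConfig V, F (openEdgeCluster ω s) ≠ F ∅ → (openGraph ω).Reachable s y) :
    (0 ≤ polMargin (prodBernoulli w) s y z F (insert u X) X X + polMargin (prodBernoulli w) s y z F X (insert u X) X +
        polMargin (prodBernoulli w) s y z F X X (insert u X)) ∧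
      0 ≤ polMargin (prodBernoulli w) s y z F (insert u X) (insert u X) X + polMargin (prodBernoulli w) s y z F (insert u X) X (insert u X) +
        polMargin (prodBernoulli w) s y z F X (insert u X) (insert u X) := by
  -- restate with `members` and induct on the number of values of `F`
  suffices key : ∀ (n : ℕ) (F : Set (Sym2 V) → ℝ), Monotone F →
      (∀ ω : BondConfig V, F (openEdgeCluster ω s) ≠ F ∅ → (openGraph ω).Reachable s y) →
      (Set.finite_range F).toFinset.card = n →
      0 ≤ (polMargin (prodBernoulli w) s y z F (insert u X) X X + polMargin (prodBernoulli w) s y z F X (insert u X) X +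
          polMargin (prodBernoulli w) s y z F X X (insert u X)) ∧
        0 ≤ (polMargin (prodBernoulli w) s y z F (insert u X) (insert u X) X + polMargin (prodBernoulli w) s y z F (insert u X) X (insert u X) +
          polMargin (prodBernoulli w) s y z F X (insert u X) (insert u X)) by
    exact key _ F hF hFy rfl
  intro n
  induction n using Nat.strong_induction_on with
  | _ n ih =>
  intro F hF hFy hn
  by_cases hconst : ∀ C, F C = F ∅
  · -- constant functional: both members vanish
    have hFc : F = fun _ => F ∅ := funext hconst
    rw [hFc]
    simp only [polMargin_const', add_zero, le_refl, and_self]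
  push Not at hconst
  obtain ⟨C₀, hC₀⟩ := hconst
  set m := F ∅ with hm
  -- the second-smallest value `m'`
  set T := (Set.finite_range F).toFinset.erase m with hT
  have hTne : T.Nonempty := ⟨F C₀, Finset.mem_erase.mpr ⟨hC₀, (Set.finite_range F).mem_toFinset.mpr ⟨C₀, rfl⟩⟩⟩
  set m' := T.min' hTne with hm'
  have hm'T : m' ∈ T := Finset.min'_mem T hTne
  have hm'ne : m' ≠ m := (Finset.mem_erase.mp hm'T).1
  have hmin : ∀ C, m ≤ F C := fun C => hF (empty_subset C)
  have hmm' : m < m' := by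
    obtain ⟨C, hC⟩ : ∃ C, F C = m' := by
      have := (Finset.mem_erase.mp hm'T).2
      rw [Set.Finite.mem_toFinset] at this
      exact this
    exact lt_of_le_of_ne (hC ▸ hmin C) (Ne.symm hm'ne)
  have hgap : ∀ C, F C < m' → F C = m := by
    intro C hC
    by_contra hne
    have hmem : F C ∈ T := Finset.mem_erase.mpr ⟨hne, (Set.finite_range F).mem_toFinset.mpr ⟨C, rfl⟩⟩
    exact absurd (Finset.min'_le T (F C) hmem) (not_le.mpr (hm' ▸ hC))
  -- the level-set indicator `G = 1{F ≥ m'}` and the truncated functional `F' = max(F, m')`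
  set G : Set (Sym2 V) → ℝ := fun C => if m' ≤ F C then 1 else 0 with hG
  set F' : Set (Sym2 V) → ℝ := fun C => max (F C) m' with hF'
  have hGm : Monotone G := by
    intro C C' hCC'
    simp only [hG]
    by_cases h : m' ≤ F C
    · rw [if_pos h, if_pos (h.trans (hF hCC'))]
    · rw [if_neg h]; split_ifs <;> norm_num
  have hG01 : ∀ C, G C = 0 ∨ G C = 1 := fun C => by simp only [hG]; split_ifs <;> simp
  have hGy : ∀ ω : BondConfig V, G (openEdgeCluster ω s) = 1 → (openGraph ω).Reachable s y := by
    intro ω h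
    have hle : m' ≤ F (openEdgeCluster ω s) := by
      by_contra hn; simp only [hG, if_neg hn] at h; exact zero_ne_one h
    exact hFy ω (ne_of_gt (hmm'.trans_le hle))
  have hF'm : Monotone F' := fun C C' hCC' => max_le_max (hF hCC') le_rfl
  have hF'e : F' ∅ = m' := by simp only [hF']; exact max_eq_right hmm'.le
  have hF'y : ∀ ω : BondConfig V, F' (openEdgeCluster ω s) ≠ F' ∅ → (openGraph ω).Reachable s y := by
    intro ω h
    rw [hF'e] at h
    have hgt : m' < F (openEdgeCluster ω s) := by
      by_contra hn
      exact h (by simp only [hF']; exact max_eq_right (not_lt.mp hn))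
    exact hFy ω (ne_of_gt (hmm'.trans hgt))
  -- the decomposition `F = (F' + (m' - m)·G) - (m' - m)... ` pointwise: `F C = F' C + (m - m') * (1 - G C)`; we use `F = (F' + (m'-m)G) - (m'-m)`
  have hdec : F = fun C => (fun C => F' C + (m' - m) * G C) C + (m - m') * (fun _ : Set (Sym2 V) => (1 : ℝ)) C := by
    funext C
    simp only [hF', hG]
    by_cases h : m' ≤ F C
    · rw [if_pos h, max_eq_left h]; ring
    · rw [if_neg h, max_eq_right (not_le.mp h).le, hgap C (not_le.mp h)]; ring
  -- fewer values: `range F' = range F ∖ {m}`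
  have hcard : (Set.finite_range F').toFinset.card < n := by
    have hsub : (Set.finite_range F').toFinset = T := by
      ext v
      simp only [hT, Finset.mem_erase, Set.Finite.mem_toFinset, Set.mem_range]
      constructor
      · rintro ⟨C, rfl⟩
        refine ⟨?_, ?_⟩
        · simp only [hF']; exact ne_of_gt (hmm'.trans_le (le_max_right _ _))
        · by_cases h : m' ≤ F C
          · exact ⟨C, by simp only [hF', max_eq_left h]⟩
          · obtain ⟨C', hC'⟩ : ∃ C', F C' = m' := by
              have := (Finset.mem_erase.mp hm'T).2
              rw [Set.Finite.mem_toFinset] at this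
              exact this
            exact ⟨C', by simp only [hF', max_eq_right (not_le.mp h).le, hC']⟩
      · rintro ⟨hne, C, rfl⟩
        refine ⟨C, ?_⟩
        simp only [hF']
        exact max_eq_left (not_lt.mp fun hlt => hne (hgap C hlt))
    rw [hsub, hT, Finset.card_erase_of_mem ((Set.finite_range F).mem_toFinset.mpr ⟨∅, rfl⟩), hn]
    have : 0 < n := by
      rw [← hn]; exact Finset.card_pos.mpr ⟨m, (Set.finite_range F).mem_toFinset.mpr ⟨∅, rfl⟩⟩
    omega
  have ihF' := ih _ hcard F' hF'm hF'y rfl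
  have hGpos := h01 G hGm hG01 hGy
  have hc : 0 ≤ m' - m := sub_nonneg.mpr hmm'.le
  have p1 := mul_nonneg hc hGpos.1
  have p2 := mul_nonneg hc hGpos.2
  rw [hdec]
  simp only [polMargin_add_mul, polMargin_const', mul_zero, add_zero]
  constructor
  · nlinarith [ihF'.1, p1]
  · nlinarith [ihF'.2, p2]

/-- **Layer cake, saturated class.**  See the module docstring. [folklore; cite: VandenbergHaggstromKahn2005, §2.1 (pp. 9–13) for the members] -/
theorem crossMembers_nonneg_of_levelSets_saturated (w : Sym2 V → unitInterval) (s y z u : V) (X : Set V)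
    (h01 : ∀ G : Set (Sym2 V) → ℝ, Monotone G → (∀ C, G C = 0 ∨ G C = 1) →
      (∀ ω : BondConfig V, (openGraph ω).Reachable s y → G (openEdgeCluster ω s) = 1) →
      (0 ≤ polMargin (prodBernoulli w) s y z G (insert u X) X X + polMargin (prodBernoulli w) s y z G X (insert u X) X +
          polMargin (prodBernoulli w) s y z G X X (insert u X)) ∧
        0 ≤ polMargin (prodBernoulli w) s y z G (insert u X) (insert u X) X + polMargin (prodBernoulli w) s y z G (insert u X) X (insert u X) +
          polMargin (prodBernoulli w) s y z G X (insert u X) (insert u X))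
    (F : Set (Sym2 V) → ℝ) (hF : Monotone F)
    (hFy : ∀ ω : BondConfig V, (openGraph ω).Reachable s y → F (openEdgeCluster ω s) = F Set.univ) :
    (0 ≤ polMargin (prodBernoulli w) s y z F (insert u X) X X + polMargin (prodBernoulli w) s y z F X (insert u X) X +
        polMargin (prodBernoulli w) s y z F X X (insert u X)) ∧
      0 ≤ polMargin (prodBernoulli w) s y z F (insert u X) (insert u X) X + polMargin (prodBernoulli w) s y z F (insert u X) X (insert u X) +
        polMargin (prodBernoulli w) s y z F X (insert u X) (insert u X) := by
  suffices key : ∀ (n : ℕ) (F : Set (Sym2 V) → ℝ), Monotone F →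
      (∀ ω : BondConfig V, (openGraph ω).Reachable s y → F (openEdgeCluster ω s) = F Set.univ) →
      (Set.finite_range F).toFinset.card = n →
      0 ≤ (polMargin (prodBernoulli w) s y z F (insert u X) X X + polMargin (prodBernoulli w) s y z F X (insert u X) X +
          polMargin (prodBernoulli w) s y z F X X (insert u X)) ∧
        0 ≤ (polMargin (prodBernoulli w) s y z F (insert u X) (insert u X) X + polMargin (prodBernoulli w) s y z F (insert u X) X (insert u X) +
          polMargin (prodBernoulli w) s y z F X (insert u X) (insert u X)) by
    exact key _ F hF hFy rfl
  intro n
  induction n using Nat.strong_induction_on with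
  | _ n ih =>
  intro F hF hFy hn
  by_cases hconst : ∀ C, F C = F Set.univ
  · have hFc : F = fun _ => F Set.univ := funext hconst
    rw [hFc]
    simp only [polMargin_const', add_zero, le_refl, and_self]
  push Not at hconst
  obtain ⟨C₀, hC₀⟩ := hconst
  set M := F Set.univ with hM
  -- the second-largest value `M'`
  set T := (Set.finite_range F).toFinset.erase M with hT
  have hTne : T.Nonempty := ⟨F C₀, Finset.mem_erase.mpr ⟨hC₀, (Set.finite_range F).mem_toFinset.mpr ⟨C₀, rfl⟩⟩⟩
  set M' := T.max' hTne with hM'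
  have hM'T : M' ∈ T := Finset.max'_mem T hTne
  have hM'ne : M' ≠ M := (Finset.mem_erase.mp hM'T).1
  have hmax : ∀ C, F C ≤ M := fun C => hF (Set.subset_univ C)
  have hM'C : ∃ C, F C = M' := by
    have := (Finset.mem_erase.mp hM'T).2
    rw [Set.Finite.mem_toFinset] at this
    exact this
  have hMM' : M' < M := by
    obtain ⟨C, hC⟩ := hM'C
    exact lt_of_le_of_ne (hC ▸ hmax C) hM'ne
  have hgap : ∀ C, M' < F C → F C = M := by
    intro C hC
    by_contra hne
    have hmem : F C ∈ T := Finset.mem_erase.mpr ⟨hne, (Set.finite_range F).mem_toFinset.mpr ⟨C, rfl⟩⟩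
    exact absurd (Finset.le_max' T (F C) hmem) (not_le.mpr (hM' ▸ hC))
  -- the top level-set indicator `G = 1{F = M}` and the truncated functional `F' = min(F, M')`
  set G : Set (Sym2 V) → ℝ := fun C => if M ≤ F C then 1 else 0 with hG
  set F' : Set (Sym2 V) → ℝ := fun C => min (F C) M' with hF'
  have hGm : Monotone G := by
    intro C C' hCC'
    simp only [hG]
    by_cases h : M ≤ F C
    · rw [if_pos h, if_pos (h.trans (hF hCC'))]
    · rw [if_neg h]; split_ifs <;> norm_num
  have hG01 : ∀ C, G C = 0 ∨ G C = 1 := fun C => by simp only [hG]; split_ifs <;> simp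
  have hGy : ∀ ω : BondConfig V, (openGraph ω).Reachable s y → G (openEdgeCluster ω s) = 1 := by
    intro ω h
    simp only [hG, hFy ω h, le_refl, if_true]
  have hF'm : Monotone F' := fun C C' hCC' => min_le_min (hF hCC') le_rfl
  have hF'u : F' Set.univ = M' := by simp only [hF']; exact min_eq_right hMM'.le
  have hF'y : ∀ ω : BondConfig V, (openGraph ω).Reachable s y → F' (openEdgeCluster ω s) = F' Set.univ := by
    intro ω h
    rw [hF'u]
    simp only [hF', hFy ω h]
    exact min_eq_right hMM'.le
  have hdec : F = fun C => F' C + (M - M') * G C := by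
    funext C
    simp only [hF', hG]
    by_cases h : M ≤ F C
    · rw [if_pos h, le_antisymm (hmax C) h, min_eq_right hMM'.le]; ring
    · have hle : F C ≤ M' := not_lt.mp fun hlt => h (le_of_eq (hgap C hlt).symm)
      rw [if_neg h, min_eq_left hle]; ring
  have hcard : (Set.finite_range F').toFinset.card < n := by
    have hsub : (Set.finite_range F').toFinset = T := by
      ext v
      simp only [hT, Finset.mem_erase, Set.Finite.mem_toFinset, Set.mem_range]
      constructor
      · rintro ⟨C, rfl⟩
        refine ⟨?_, ?_⟩
        · simp only [hF']; exact ne_of_lt ((min_le_right _ _).trans_lt hMM')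
        · by_cases h : F C ≤ M'
          · exact ⟨C, by simp only [hF', min_eq_left h]⟩
          · obtain ⟨C', hC'⟩ := hM'C
            exact ⟨C', by simp only [hF', min_eq_right (not_le.mp h).le, hC']⟩
      · rintro ⟨hne, C, rfl⟩
        refine ⟨C, ?_⟩
        simp only [hF']
        exact min_eq_left (not_lt.mp fun hlt => hne (hgap C hlt))
    rw [hsub, hT, Finset.card_erase_of_mem ((Set.finite_range F).mem_toFinset.mpr ⟨Set.univ, rfl⟩), hn]
    have : 0 < n := by
      rw [← hn]; exact Finset.card_pos.mpr ⟨M, (Set.finite_range F).mem_toFinset.mpr ⟨Set.univ, rfl⟩⟩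
    omega
  have ihF' := ih _ hcard F' hF'm hF'y rfl
  have hGpos := h01 G hGm hG01 hGy
  have hc : 0 ≤ M - M' := sub_nonneg.mpr hMM'.le
  have p1 := mul_nonneg hc hGpos.1
  have p2 := mul_nonneg hc hGpos.2
  rw [hdec]
  simp only [polMargin_add_mul]
  constructor
  · nlinarith [ihF'.1, p1]
  · nlinarith [ihF'.2, p2]

end Consts

end Summit.CriticalPhenomena.PercolationContinuityZ3.Theorems

end
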